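import Summits.CriticalPhenomena.PercolationContinuityZ3.Theorems.PercNearOneGluingNoHeavyLowerTailKnQuestion9Hub
import Summits.CriticalPhenomena.PercolationContinuityZ3.Theorems.PercNearOneGluingNearOneGluingShorteningReduction
import Summits.CriticalPhenomena.PercolationContinuityZ3.Theorems.PercNearOneGluingNoHeavyLowerTailPreShorteningInduction
import HarnessLib

/-!
# Kozma–Nitzan's Question 9 implies Conjecture 6 (the shortening step) and the crux sockets

Companion of `PercNearOneGluingNoHeavyLowerTailKnQuestion9Hub.lean` (prim-lf-2 gen 6; crux stmt-CriticalPhenomena-4575).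
With the one-block hub graph over the PAIR `S = {v, x}` (a new vertex glued surely to `v` and `x` — the contraction of
the pair seen from outside), Question 9 at the hub designates the minimiser of `P_w(· ↔ b)` (the pre-contraction
minimiser of Kozma–Nitzan's Conjecture 6, arXiv:2401.12397 §5.3 p. 34) and asserts the pre-FKG inequality (41) at the
glued source; restricted to `N = {a₀ ↮ v, a₀ ↮ x}` this is the set-source exchange inequality (S) of the landed
`shorteningStep_of_setSourceExchange`, whence Conjecture 6 in the registered form `stub_shorteningStep` of the line
`kn_shortening_induction` (crux stmt-CriticalPhenomena-4574) — WITHOUT using its hypothesis (39) or its induction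
hypothesis.  Also recorded: the immediate chain Question 9 ⇒ Conjecture 2 (3) ⇒ `NoHeavyLowerTail` / `NearOneGluing`
through the landed sockets.  Exact census of all these designations (prim-lf-2 CANDIDATES §GEN 6): 0 violations;
the remote / target / relay-side contractions and the pre-minimiser designation are FALSE (same place), so
"observer-local" is sharp.  No definitions, no sorries, standard axioms.
[cite: KozmaNitzan2024, Conjecture 6 (§5.3 p. 34), Question 9 (§5.5 p. 36)]
-/

noncomputable section

open MeasureTheory Set
open Literature.Probability.LatticeModels (prodBernoulli)
open Literature.Probability.Percolation
open Literature.Probability.Percolation.TwoSetConditionalAssociation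

namespace Summit.CriticalPhenomena.PercolationContinuityZ3.Theorems

/-! ### Question 9 ⇒ the shortening step (Kozma–Nitzan Conjecture 6) and the crux sockets -/

section Shortening

open KnQ9Hub

/-- The difference of the two hub events off `N = {a₀ ↮ v, a₀ ↮ x}` vanishes: if `a₀` is joined to the glued pair then
both (41)-events at the hub say "the pair is joined to `b`". [this file] -/
theorem hubEvents_diff_eq {n : ℕ} (A : Finset (Fin n)) (b v x a₀ : Fin n) :
    {ω : BondConfig (Fin n) | ((openGraph ω).Reachable a₀ b ∨
        ∃ s ∈ ({v, x} : Set (Fin n)), ∃ s' ∈ ({v, x} : Set (Fin n)),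
          (openGraph ω).Reachable a₀ s ∧ (openGraph ω).Reachable s' b) ∧
        ∃ a' ∈ A, ∃ s ∈ ({v, x} : Set (Fin n)), (openGraph ω).Reachable s a'} \
      {ω | ¬ (openGraph ω).Reachable a₀ v ∧ ¬ (openGraph ω).Reachable a₀ x} =
    {ω : BondConfig (Fin n) | (∃ s ∈ ({v, x} : Set (Fin n)), (openGraph ω).Reachable s b) ∧
        ∃ a' ∈ A, ∃ s ∈ ({v, x} : Set (Fin n)), (openGraph ω).Reachable s a'} \
      {ω | ¬ (openGraph ω).Reachable a₀ v ∧ ¬ (openGraph ω).Reachable a₀ x} := by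
  ext ω
  simp only [mem_sdiff, mem_setOf_eq, not_and_or, not_not, mem_insert_iff, mem_singleton_iff]
  constructor
  · rintro ⟨⟨h1, hA⟩, hN⟩
    refine ⟨⟨?_, hA⟩, hN⟩
    -- some `s₀ ∈ {v, x}` is joined to `a₀`
    have hs₀ : ∃ s₀, (s₀ = v ∨ s₀ = x) ∧ (openGraph ω).Reachable a₀ s₀ := by
      rcases hN with h | h
      · exact ⟨v, Or.inl rfl, h⟩
      · exact ⟨x, Or.inr rfl, h⟩
    obtain ⟨s₀, hs₀S, has₀⟩ := hs₀
    rcases h1 with hab | ⟨s, -, s', hs', -, hs'b⟩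
    · exact ⟨s₀, hs₀S, has₀.symm.trans hab⟩
    · exact ⟨s', hs', hs'b⟩
  · rintro ⟨⟨⟨s, hs, hsb⟩, hA⟩, hN⟩
    refine ⟨⟨?_, hA⟩, hN⟩
    have hs₀ : ∃ s₀, (s₀ = v ∨ s₀ = x) ∧ (openGraph ω).Reachable a₀ s₀ := by
      rcases hN with h | h
      · exact ⟨v, Or.inl rfl, h⟩
      · exact ⟨x, Or.inr rfl, h⟩
    obtain ⟨s₀, hs₀S, has₀⟩ := hs₀
    exact Or.inr ⟨s₀, hs₀S, s, hs, has₀, hsb⟩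

/-- **Question 9 implies the set-source exchange inequality (S) of the shortening step**, hence (by the landed
`shorteningStep_of_setSourceExchange`) Kozma–Nitzan's Conjecture 6 without its hypothesis (39).  Proof: Question 9 at
the hub of the one-block hub graph over `S = {v, x}` (a new vertex glued surely to `v` and `x`); its designation is the
minimiser of `P_w(· ↔ b)` (`KnQ9Hub.real_restrW_hub`), its conclusion is the (41)-form at the glued source
(`KnQ9Hub.real_hub_pre/concl`), and restricting to `N = {a₀ ↮ v, a₀ ↮ x}` (off `N` the two events coincide,
`hubEvents_diff_eq`) gives (S). [cite: KozmaNitzan2024, Conjecture 6 (§5.3 p. 34), Question 9 (§5.5 p. 36)] -/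
theorem setSourceExchange_of_question9
    (hQ9 : ∀ (W : Type) [Fintype W] [DecidableEq W] (w : Sym2 W → unitInterval) (A : Finset W) (o b a : W),
      o ∉ A → a ∈ A →
      (∀ a' ∈ A, (prodBernoulli (restrW ({o}ᶜ : Set W) w)).real (openConn a b) ≤
        (prodBernoulli (restrW ({o}ᶜ : Set W) w)).real (openConn a' b)) →
      (prodBernoulli w).real (openConn a b ∩ SoloBlindKN.connTo o A) ≤
        (prodBernoulli w).real (openConn o b ∩ SoloBlindKN.connTo o A))
    {n : ℕ} (w : Sym2 (Fin n) → unitInterval) (A : Finset (Fin n)) (b v x a₀ : Fin n) (ha₀ : a₀ ∈ A)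
    (hmin : ∀ a ∈ A, (prodBernoulli w).real (openConn a₀ b) ≤ (prodBernoulli w).real (openConn a b)) :
    (prodBernoulli w).real (openConn a₀ b ∩ {ω | (∃ a ∈ A, (openGraph ω).Reachable v a ∨ (openGraph ω).Reachable x a) ∧
        ¬ (openGraph ω).Reachable a₀ v ∧ ¬ (openGraph ω).Reachable a₀ x}) ≤
      (prodBernoulli w).real ((openConn v b ∪ openConn x b) ∩
        {ω | ¬ (openGraph ω).Reachable a₀ v ∧ ¬ (openGraph ω).Reachable a₀ x}) := by
  -- Question 9 at the hub of the hub graph over `{v, x}`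
  have hg : (Sum.inr true : Fin n ⊕ Bool) ∉ A.map Function.Embedding.inl := by simp
  have ha' : (Sum.inl a₀ : Fin n ⊕ Bool) ∈ A.map Function.Embedding.inl := by simpa using ha₀
  have hmin' : ∀ a' ∈ A.map Function.Embedding.inl,
      (prodBernoulli (restrW ({Sum.inr true}ᶜ : Set (Fin n ⊕ Bool)) (hubWeight w (sides ({v, x} : Set (Fin n)) ∅)))).real
          (openConn (Sum.inl a₀) (Sum.inl b)) ≤
        (prodBernoulli (restrW ({Sum.inr true}ᶜ : Set (Fin n ⊕ Bool)) (hubWeight w (sides ({v, x} : Set (Fin n)) ∅)))).real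
          (openConn a' (Sum.inl b)) := by
    intro a' ha'
    obtain ⟨a'', ha'', rfl⟩ := Finset.mem_map.1 ha'
    rw [Function.Embedding.inl_apply, real_restrW_hub, real_restrW_hub]
    exact hmin a'' ha''
  have key := hQ9 (Fin n ⊕ Bool) (hubWeight w (sides ({v, x} : Set (Fin n)) ∅)) (A.map Function.Embedding.inl)
    (Sum.inr true) (Sum.inl b) (Sum.inl a₀) hg ha' hmin'
  rw [real_hub_pre, real_hub_concl] at key
  -- restrict to `N`: off `N` the two events coincide
  set N : Set (BondConfig (Fin n)) := {ω | ¬ (openGraph ω).Reachable a₀ v ∧ ¬ (openGraph ω).Reachable a₀ x} with hN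
  set E₁ : Set (BondConfig (Fin n)) := {ω | ((openGraph ω).Reachable a₀ b ∨
      ∃ s ∈ ({v, x} : Set (Fin n)), ∃ s' ∈ ({v, x} : Set (Fin n)),
        (openGraph ω).Reachable a₀ s ∧ (openGraph ω).Reachable s' b) ∧
      ∃ a' ∈ A, ∃ s ∈ ({v, x} : Set (Fin n)), (openGraph ω).Reachable s a'} with hE₁
  set E₂ : Set (BondConfig (Fin n)) := {ω | (∃ s ∈ ({v, x} : Set (Fin n)), (openGraph ω).Reachable s b) ∧
      ∃ a' ∈ A, ∃ s ∈ ({v, x} : Set (Fin n)), (openGraph ω).Reachable s a'} with hE₂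
  have hmeas : ∀ T : Set (BondConfig (Fin n)), MeasurableSet T := fun T => MeasurableSet.of_discrete
  have hdiff : E₁ \ N = E₂ \ N := hubEvents_diff_eq A b v x a₀
  have h1 := measureReal_inter_add_sdiff (μ := prodBernoulli w) (s := E₁) (hmeas N) (measure_ne_top _ _)
  have h2 := measureReal_inter_add_sdiff (μ := prodBernoulli w) (s := E₂) (hmeas N) (measure_ne_top _ _)
  rw [hdiff] at h1
  have hEN : (prodBernoulli w).real (E₁ ∩ N) ≤ (prodBernoulli w).real (E₂ ∩ N) := by linarith
  -- `E₁ ∩ N` is the left event of (S), `E₂ ∩ N` is contained in the right event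
  have hL : openConn a₀ b ∩ {ω | (∃ a ∈ A, (openGraph ω).Reachable v a ∨ (openGraph ω).Reachable x a) ∧
      ¬ (openGraph ω).Reachable a₀ v ∧ ¬ (openGraph ω).Reachable a₀ x} ⊆ E₁ ∩ N := by
    rintro ω ⟨hab, ⟨a', ha', hva⟩, hv, hx⟩
    refine ⟨⟨Or.inl hab, a', ha', ?_⟩, hv, hx⟩
    rcases hva with h | h
    · exact ⟨v, Or.inl rfl, h⟩
    · exact ⟨x, Or.inr rfl, h⟩
  have hR : E₂ ∩ N ⊆ (openConn v b ∪ openConn x b) ∩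
      {ω | ¬ (openGraph ω).Reachable a₀ v ∧ ¬ (openGraph ω).Reachable a₀ x} := by
    rintro ω ⟨⟨⟨s, hs, hsb⟩, -⟩, hωN⟩
    refine ⟨?_, hωN⟩
    rcases hs with rfl | rfl
    · exact Or.inl hsb
    · exact Or.inr hsb
  exact (measureReal_mono hL (measure_ne_top _ _)).trans (hEN.trans (measureReal_mono hR (measure_ne_top _ _)))

/-- **Question 9 implies Kozma–Nitzan's Conjecture 6 in the registered form `stub_shorteningStep`** (line
`kn_shortening_induction` of the sibling crux stmt-CriticalPhenomena-4574; the hypotheses (39) and the induction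
hypothesis of the stub are not even used): `μ₁(v ↔ A)·μ₁(a₀ ↔ b) ≤ μ₁(v ↔ b)` in `w[s(v,x) ↦ 1]` for the pre-contraction
minimiser `a₀`.  `setSourceExchange_of_question9` + `shorteningStep_of_setSourceExchange`.
[cite: KozmaNitzan2024, Conjecture 6 (§5.3 p. 34), Question 9 (§5.5 p. 36)] -/
theorem shorteningStep_of_question9
    (hQ9 : ∀ (W : Type) [Fintype W] [DecidableEq W] (w : Sym2 W → unitInterval) (A : Finset W) (o b a : W),
      o ∉ A → a ∈ A →
      (∀ a' ∈ A, (prodBernoulli (restrW ({o}ᶜ : Set W) w)).real (openConn a b) ≤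
        (prodBernoulli (restrW ({o}ᶜ : Set W) w)).real (openConn a' b)) →
      (prodBernoulli w).real (openConn a b ∩ SoloBlindKN.connTo o A) ≤
        (prodBernoulli w).real (openConn o b ∩ SoloBlindKN.connTo o A)) :
    ∀ (n : ℕ) (w : Sym2 (Fin n) → unitInterval) (A : Finset (Fin n)) (b v x a₀ : Fin n),
      v ∉ A → v ≠ x → w s(v, x) = 0 → a₀ ∈ A →
      (∀ a ∈ A, (prodBernoulli w).real (openConn a₀ b) ≤ (prodBernoulli w).real (openConn a b)) →
      (∀ w' : Sym2 (Fin n) → unitInterval, (∀ e, w e = 0 → w' e = 0) →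
        ∀ (A' : Finset (Fin n)) (o' b' : Fin n) (t : ℝ),
          (∀ a ∈ A', t ≤ (prodBernoulli w').real (openConn a b')) →
          (prodBernoulli w').real (⋃ a ∈ A', openConn o' a) * t ≤ (prodBernoulli w').real (openConn o' b')) →
      (prodBernoulli (Function.update w s(v, x) 1)).real (⋃ a ∈ A, openConn v a) *
          (prodBernoulli (Function.update w s(v, x) 1)).real (openConn a₀ b) ≤
        (prodBernoulli (Function.update w s(v, x) 1)).real (openConn v b) := by
  intro n w A b v x a₀ _hvA hvx _hw ha₀ hmin _hIH
  exact shorteningStep_of_setSourceExchange n w A b v x a₀ hvx (setSourceExchange_of_question9 hQ9 w A b v x a₀ ha₀ hmin)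

/-- **Question 9 ⇒ Kozma–Nitzan's Conjecture 2 in form (3)** (min-free, the hypothesis shape of
`additiveConjecture1_of_conjecture2form`): take the Question-9 designation. [cite: KozmaNitzan2024, Question 9 (p. 36)] -/
theorem conjecture2form_of_question9
    (hQ9 : ∀ (W : Type) [Fintype W] [DecidableEq W] (w : Sym2 W → unitInterval) (A : Finset W) (o b a : W),
      o ∉ A → a ∈ A →
      (∀ a' ∈ A, (prodBernoulli (restrW ({o}ᶜ : Set W) w)).real (openConn a b) ≤
        (prodBernoulli (restrW ({o}ᶜ : Set W) w)).real (openConn a' b)) →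
      (prodBernoulli w).real (openConn a b ∩ SoloBlindKN.connTo o A) ≤
        (prodBernoulli w).real (openConn o b ∩ SoloBlindKN.connTo o A)) :
    ∀ (n : ℕ) (w : Sym2 (Fin n) → unitInterval) (A : Finset (Fin n)) (o b : Fin n) (t : ℝ), A.Nonempty →
      (∀ a ∈ A, t ≤ (prodBernoulli w).real ((⋃ a' ∈ A, openConn o a') ∩ openConn a b)) →
      t ≤ (prodBernoulli w).real (openConn o b ∩ ⋃ a' ∈ A, openConn o a') := by
  intro n w A o b t hA ht
  by_cases hoA : o ∈ A
  · have h := ht o hoA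
    rwa [inter_comm] at h
  obtain ⟨a, ha, hmin⟩ :=
    A.exists_min_image (fun a' => (prodBernoulli (restrW ({o}ᶜ : Set (Fin n)) w)).real (openConn a' b)) hA
  have key := hQ9 (Fin n) w A o b a hoA ha hmin
  have hta := ht a ha
  rw [inter_comm] at hta
  exact hta.trans key

/-- **Question 9 ⇒ `NoHeavyLowerTail`** (crux stmt-CriticalPhenomena-4575), through Conjecture 2 (3) ⇒ additive
Conjecture 1 ⇒ the landed socket. [cite: KozmaNitzan2024, Question 9 (p. 36)] -/
theorem noHeavyLowerTail_of_question9
    (hQ9 : ∀ (W : Type) [Fintype W] [DecidableEq W] (w : Sym2 W → unitInterval) (A : Finset W) (o b a : W),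
      o ∉ A → a ∈ A →
      (∀ a' ∈ A, (prodBernoulli (restrW ({o}ᶜ : Set W) w)).real (openConn a b) ≤
        (prodBernoulli (restrW ({o}ᶜ : Set W) w)).real (openConn a' b)) →
      (prodBernoulli w).real (openConn a b ∩ SoloBlindKN.connTo o A) ≤
        (prodBernoulli w).real (openConn o b ∩ SoloBlindKN.connTo o A)) :
    Summit.CriticalPhenomena.PercolationContinuityZ3.Theses.PercNearOneGluingNoHeavy.NoHeavyLowerTail :=
  noHeavyLowerTail_of_additiveConjecture1 (additiveConjecture1_of_conjecture2form (conjecture2form_of_question9 hQ9))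

/-- **Question 9 ⇒ `NearOneGluing`** (= Kozma–Nitzan Conjecture 3, crux stmt-CriticalPhenomena-4574).
[cite: KozmaNitzan2024, Question 9 (p. 36), Conjecture 3 (p. 15)] -/
theorem nearOneGluing_of_question9
    (hQ9 : ∀ (W : Type) [Fintype W] [DecidableEq W] (w : Sym2 W → unitInterval) (A : Finset W) (o b a : W),
      o ∉ A → a ∈ A →
      (∀ a' ∈ A, (prodBernoulli (restrW ({o}ᶜ : Set W) w)).real (openConn a b) ≤
        (prodBernoulli (restrW ({o}ᶜ : Set W) w)).real (openConn a' b)) →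
      (prodBernoulli w).real (openConn a b ∩ SoloBlindKN.connTo o A) ≤
        (prodBernoulli w).real (openConn o b ∩ SoloBlindKN.connTo o A)) :
    Summit.CriticalPhenomena.PercolationContinuityZ3.Theses.PercNearOneGluingNoHeavy.NearOneGluing :=
  nearOneGluing_of_conjecture1form (conjecture1_of_conjecture2form (conjecture2form_of_question9 hQ9))

end Shortening

end Summit.CriticalPhenomena.PercolationContinuityZ3.Theorems
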